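import Summits.Ventures.HSemireg.PhaseTorusLawCoranks
import Summits.Ventures.HSemireg.PhaseTorusBoxLaw

/-!
# The phase-torus law at corank `≤ 10`: box law + double counting over one box class
# (HSemireg support file; phase-torus line, «control» lens g6 CYCLE LINE «BOX LAW ∕ μ-LATTICE», torus level, module 2 of 2)

Crux of record: `Summit.HodgeConjecture.HodgeConjecture.Theses.EightfoldBlochSeeds.BlochSeedDiscOne`
(= `HasHyperbolicBlochSeed 4 1`, item stmt-HodgeConjecture-18881; skeleton `Lines/birth.lean`, STUB R `stub_rung_pad4_seedAt`,
named technique = PAD-4 two-level ⊕-block design with a TWO-TERM line-bundle presentation).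
Nothing in this file proves HC, HC_AV, HC_CM, H2 or item 18881; census-neutral (no SAT∕UNSAT row is added or changed).

WHAT THIS FILE IS (tree copy of §6 of the crux workfile `Cruxes/BlochSeedDiscOne/PhaseTorusBoxLaw.lean` 7f939b9519446d9e, author
plan-lens-HodgeAV-control g6, statements verbatim; memo `Cruxes/BlochSeedDiscOne/BOX-LAW-g6.md` §2; director-hodge words «K-μ32»∕«K-UP10»):
**`phaseTorusLawN_ten : PhaseTorusLawN 10`** — a clean real signed measure on `(ℤ∕4)⁴` that is `≤ 0` off a set `A` of at most `10`
phases has `μ = moment ω (1,1,1,1) = 0`.  Proof: if `μ ≠ 0`, one of `Re μ`, `Im μ` is non-zero, so by the BOX LAW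
`32·N(s) = −Re(e(−Σ s)·μ)` (`PhaseTorusBoxLaw.boxSumLaw`, the workfile's `boxLaw`) every box of ONE corner class `{s : Σ_f s_f = j}` (64 corners, `cornerClass j`)
has positive mass, hence meets `A` (`exists_mem_of_boxSum_pos`); but a point lies in at most `6` boxes of a class
(`card_corners_containing_le`: the boxes of class `j` through `a` are indexed by the subsets `U ⊆ Fin 4` with `|U| ≡ Σa − j (mod 4)`,
at most `6` of them, `card_subsets_le_six`), so `64 ≤ 6·|A|`, i.e. `|A| ≥ 11`.
Everything here is PROVED (axioms `propext`, `Classical.choice`, `Quot.sound`; no `sorry`, no named fact, no instance, no notation).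

WHAT IT IS NOT: a statement about sheaves, monads, a SOURCE or a SEED.  With `PhaseTorusLawCoranks.not_phaseTorusLawN_sixteen` the
critical corank satisfies `11 ≤ γ* ≤ 16` from tree files (the crux-dir pen+machine value is `γ* = 14`, memo BOX-LAW-g6.md; not typed).
The design-level consequence — the UP two-term law through corank 10, `lineTwoTermUp_mu_eq_zero_of_law 10` discharged — is
`Pad4TowerLineBoxLaw`.
Tree filing: hsemireg-phasetorus-typer-1 g2.
-/

namespace Summit.Ventures.HSemireg.PhaseTorus

open Finset BigOperators

/-! ## The corner classes, double counting, and the law at corank `≤ 10` -/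

/-- the corner of class `j` with prescribed first three coordinates. -/
def cornerOf (j : ZMod 4) (t : Fin 3 → ZMod 4) : PT := ![t 0, t 1, t 2, j - (t 0 + t 1 + t 2)]

/-- the 64 corners `s` with `Σ_f s f = j`. -/
def cornerClass (j : ZMod 4) : Finset PT := Finset.univ.image (cornerOf j)

/-- `cornerOf j` is injective (the first three coordinates are read off). -/
theorem cornerOf_injective (j : ZMod 4) : Function.Injective (cornerOf j) := by
  intro t t' h
  have h0 := congr_fun h 0
  have h1 := congr_fun h 1
  have h2 := congr_fun h 2
  simp [cornerOf] at h0 h1 h2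
  funext i
  fin_cases i
  · exact h0
  · exact h1
  · exact h2

/-- each corner class has `64` corners. -/
theorem cornerClass_card (j : ZMod 4) : (cornerClass j).card = 64 := by
  rw [cornerClass, Finset.card_image_of_injective _ (cornerOf_injective j), Finset.card_univ, Fintype.card_fun,
    ZMod.card, Fintype.card_fin]
  norm_num

/-- the coordinate sum of `cornerOf j t` is `j`. -/
theorem sum_cornerOf (j : ZMod 4) (t : Fin 3 → ZMod 4) : ∑ f, cornerOf j t f = j := by
  rw [Fin.sum_univ_four]
  simp [cornerOf]

/-- every corner of class `j` has coordinate sum `j`. -/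
theorem sum_of_mem_cornerClass {j : ZMod 4} {s : PT} (hs : s ∈ cornerClass j) : ∑ f, s f = j := by
  obtain ⟨t, _, rfl⟩ := Finset.mem_image.1 hs
  exact sum_cornerOf j t

/-- a box of positive mass contains a point of the positive set. -/
theorem exists_mem_of_boxSum_pos (ω : PT → ℝ) (A : Finset PT) (hω : ∀ τ, τ ∉ A → ω τ ≤ 0) (s : PT)
    (h : 0 < boxSum ω s) : ∃ a ∈ A, a ∈ pbox s := by
  by_contra hc
  push Not at hc
  have : boxSum ω s ≤ 0 := Finset.sum_nonpos fun τ hτ => hω τ (fun ha => hc τ ha hτ)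
  linarith

/-- subsets of `Fin 4` of a given cardinality mod 4: at most `6`. -/
theorem card_subsets_le_six (r : ZMod 4) :
    ((Finset.univ : Finset (Finset (Fin 4))).filter (fun U => ((U.card : ℕ) : ZMod 4) = r)).card ≤ 6 := by
  revert r; decide

/-- `x + 1 ≠ x` in `ℤ/4`. -/
theorem succ_ne_self4 (x : ZMod 4) : x + 1 ≠ x := by
  rw [add_comm]; exact one_add_ne x

/-- a point lies in at most `6` boxes of one class. -/
theorem card_corners_containing_le (j : ZMod 4) (a : PT) :
    ((cornerClass j).filter fun s => a ∈ pbox s).card ≤ 6 := by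
  let T : PT → Finset (Fin 4) := fun s => Finset.univ.filter fun f => a f = s f + 1
  calc ((cornerClass j).filter fun s => a ∈ pbox s).card
      ≤ ((Finset.univ : Finset (Finset (Fin 4))).filter (fun U => ((U.card : ℕ) : ZMod 4) = ∑ f, a f - j)).card := by
        apply Finset.card_le_card_of_injOn T
        · intro s hs
          have hs' : s ∈ (cornerClass j).filter fun s => a ∈ pbox s := by exact_mod_cast hs
          obtain ⟨hsj, hbox⟩ := Finset.mem_filter.1 hs'
          have goal : T s ∈ (Finset.univ : Finset (Finset (Fin 4))).filter
              (fun U => ((U.card : ℕ) : ZMod 4) = ∑ f, a f - j) := by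
            rw [Finset.mem_filter]
            refine ⟨Finset.mem_univ _, ?_⟩
            have key : ∑ f, a f = ∑ f, s f + ((T s).card : ZMod 4) := by
              rw [Finset.card_eq_sum_ones, Nat.cast_sum, Finset.sum_filter, ← Finset.sum_add_distrib]
              refine Finset.sum_congr rfl fun f _ => ?_
              rcases (mem_pbox.1 hbox) f with h | h
              · have hne : ¬ (a f = s f + 1) := by rw [h]; exact (succ_ne_self4 (s f)).symm
                rw [if_neg hne, add_zero, h]
              · rw [if_pos h, Nat.cast_one, h]
            rw [key, sum_of_mem_cornerClass hsj]; ring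
          exact_mod_cast goal
        · intro s hs s' hs' hT
          have hs1 : s ∈ (cornerClass j).filter fun s => a ∈ pbox s := by exact_mod_cast hs
          have hs2 : s' ∈ (cornerClass j).filter fun s => a ∈ pbox s := by exact_mod_cast hs'
          have hb := (Finset.mem_filter.1 hs1).2
          have hb' := (Finset.mem_filter.1 hs2).2
          funext f
          have hf : (a f = s f + 1 ↔ a f = s' f + 1) := by
            have := congrArg (fun U => f ∈ U) hT
            simpa [T] using this
          rcases (mem_pbox.1 hb) f with h | h <;> rcases (mem_pbox.1 hb') f with h' | h'
          · rw [← h, ← h']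
          · exfalso
            have := hf.2 h'
            rw [h] at this
            exact succ_ne_self4 (s f) this.symm
          · exfalso
            have := hf.1 h
            rw [h'] at this
            exact succ_ne_self4 (s' f) this.symm
          · have := h.symm.trans h'
            exact add_right_cancel this
    _ ≤ 6 := card_subsets_le_six _

/-- **The phase-torus law at corank ≤ 10** (box law + double counting: a transversal of a box class has ≥ 11 points). -/
theorem phaseTorusLawN_ten : PhaseTorusLawN 10 := by
  classical
  intro ω A hA hω hK
  by_contra hμ
  have hcls : ∀ (j : ZMod 4) (s : PT), s ∈ cornerClass j →
      32 * boxSum ω s = -(e (-j) * moment ω (fun _ => 1)).re := by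
    intro j s hs
    rw [boxSumLaw ω hK s, sum_of_mem_cornerClass hs]
  obtain ⟨j, hj⟩ : ∃ j : ZMod 4, ∀ s ∈ cornerClass j, 0 < boxSum ω s := by
    have hre_or : (moment ω (fun _ => 1)).re ≠ 0 ∨ (moment ω (fun _ => 1)).im ≠ 0 := by
      by_contra h
      push Not at h
      exact hμ (Complex.ext (by simpa using h.1) (by simpa using h.2))
    rcases hre_or with h | h
    · rcases lt_or_gt_of_ne h with hneg | hpos
      · refine ⟨0, fun s hs => ?_⟩
        have := hcls 0 s hs
        rw [neg_zero, e_zero, one_mul] at this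
        linarith
      · refine ⟨2, fun s hs => ?_⟩
        have := hcls 2 s hs
        rw [show (-2 : ZMod 4) = 2 from by decide, e_two] at this
        simp at this
        linarith
    · rcases lt_or_gt_of_ne h with hneg | hpos
      · refine ⟨1, fun s hs => ?_⟩
        have := hcls 1 s hs
        rw [e_neg_one] at this
        simp at this
        linarith
      · refine ⟨3, fun s hs => ?_⟩
        have := hcls 3 s hs
        rw [show (-3 : ZMod 4) = 1 from by decide, e_one] at this
        simp at this
        linarith
  have hmeet : ∀ s ∈ cornerClass j, ∃ a ∈ A, a ∈ pbox s :=
    fun s hs => exists_mem_of_boxSum_pos ω A hω s (hj s hs)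
  choose! g hgA hgbox using hmeet
  have h1 : (cornerClass j).card ≤ 6 * ((cornerClass j).image g).card := by
    apply Finset.card_le_mul_card_image
    intro a _
    calc ((cornerClass j).filter fun s => g s = a).card
        ≤ ((cornerClass j).filter fun s => a ∈ pbox s).card := by
          apply Finset.card_le_card
          intro s hs
          rw [Finset.mem_filter] at hs ⊢
          exact ⟨hs.1, hs.2 ▸ hgbox s hs.1⟩
      _ ≤ 6 := card_corners_containing_le j a
  have h2 : ((cornerClass j).image g).card ≤ A.card :=
    Finset.card_le_card (Finset.image_subset_iff.2 fun s hs => hgA s hs)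
  rw [cornerClass_card] at h1
  omega

end Summit.Ventures.HSemireg.PhaseTorus
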